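import Summits.KontsevichZagierPeriods.KontsevichZagierPeriods.Theses.HermiteRigidity
import Literature.NumberTheory.Transcendental.KZVolumeConjectureProofs
import Literature.NumberTheory.Transcendental.KZKernelConjectureForms
import Literature.NumberTheory.Transcendental.KZRelationsLE

/-!
# Sketch (crux-ideate, round 1, ideator 2) — crux `ReductionRigidity` (stmt-KontsevichZagierPeriods-3407)

Idea card `compact-volume-basis`: the `∃ B` of the crux is CONSTRUCTIVE and transcendence-free
once the compact volume form of Conjecture 1 is granted, and conversely; the rigid reducing family
is a greedy/Zorn value-basis chosen among COMPACT VOLUMES (Viu-Sos' semi-canonical reduction,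
already a tree theorem `KZ.semiCanonicalReduction_holds`).

* `CompactVolumeForm` — C⁺, the body of `KZ.volumeConjectureCompact` inlined (= item 3814's
  `VolumeForm` with the compactness / non-empty-interior hypotheses of Cresson–Viu-Sos).
* `kernelForm_of_compactVolumeForm` — PROVED from tree theorems.
* `reductionRigidity_of_kernelForm` — PROVED (re-proof of support item 14406: B = a section of
  `value` over a maximal `K`-linearly independent family of values, `K` = real algebraic numbers).
* `reductionRigidity_of_compactVolumeForm` — the card's FIRST LEMMA, PROVED.
* `IntegralReductionRigidity` — the integral form X_ℤ of the crux (no algebraic rescalings, no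
  real coefficients: ℚ-independent values, integer multiples, ℤ-span); PROVED: `kernelForm_of_integral`
  (TorsionFree → X_ℤ → kernel form), `integral_of_kernelForm` (kernel form → X_ℤ) and the second
  concluding composition `reductionRigidity_of_integral : TorsionFree → X_ℤ → ReductionRigidity`.

Whole file: lean check rc 0, 0 sorries, 0 warnings; every theorem depends only on propext,
Classical.choice, Quot.sound.
-/

noncomputable section

set_option linter.dupNamespace false

open MeasureTheory Set
open Literature.NumberTheory.Transcendental

namespace Summit.KontsevichZagierPeriods.KontsevichZagierPeriods.Cruxes.ReductionRigidity.CompactVolumeBasis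

open Summit.KontsevichZagierPeriods.KontsevichZagierPeriods.Theses.HermiteRigidity

/-- C⁺ (transfer target): the compact volume form of Conjecture 1 — two integrand-`1`
representations on compact `ℚ`-semialgebraic domains with non-empty interior, of one dimension,
with equal volume are KZ-equivalent (Cresson–Viu-Sos 2022 §1; body of
`KZ.volumeConjectureCompact`, inlined so that no `@[conjecture]` constant is named). -/
def CompactVolumeForm : Prop :=
  ∀ ⦃d : ℕ⦄ (r r' : KZ.IntegralRep d),
    IsCompact r.domain → (interior r.domain).Nonempty →
    IsCompact r'.domain → (interior r'.domain).Nonempty →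
    (∀ x ∈ r.domain, r.integrand x = 1) → (∀ x ∈ r'.domain, r'.integrand x = 1) →
    r.value = r'.value → KZ.Equivalent r r'

theorem compactVolumeForm_iff : CompactVolumeForm ↔ KZ.volumeConjectureCompact := Iff.rfl

/-- Kernel form of Conjecture 1, inlined. -/
def KernelForm : Prop := ∀ c : KZ.FormalRep, KZ.eval c = 0 → c ∈ KZ.relations

/-- Compact volume form ⇒ kernel form: tree theorems only (Viu-Sos' semi-canonical reduction
inside the rules, `KZ.semiCanonicalReduction_holds`; `KZ.kzPeriodConjecture'_of_volumeConjectureCompact`;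
`KZKernelConjecture.of_kzPeriodConjecture'`). -/
theorem kernelForm_of_compactVolumeForm (h : CompactVolumeForm) : KernelForm :=
  fun c hc => (KZKernelConjecture.of_kzPeriodConjecture'
    (KZ.kzPeriodConjecture'_of_volumeConjectureCompact KZ.semiCanonicalReduction_holds h)) c hc

/-- Kernel form ⇒ the crux (re-proof of support item 14406). `B` := representatives of a maximal
`K`-linearly independent subfamily of the set of ALL values (`K` = `algebraicClosure ℚ ℝ`, the real
algebraic numbers): RIGIDITY is linear independence; REDUCTION writes `value r` in the `K`-span,
realises each summand by an algebraically rescaled copy (`KZ.IntegralRep.constMul`) and kills the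
value-`0` difference with the kernel hypothesis. -/
theorem reductionRigidity_of_kernelForm (hK : KernelForm) : ReductionRigidity := by
  classical
  -- the field of real algebraic numbers and the set of all values
  set K : IntermediateField ℚ ℝ := algebraicClosure ℚ ℝ with hKdef
  let Vals : Set ℝ := Set.range (fun s : Σ n, KZ.IntegralRep n => s.2.value)
  obtain ⟨T, hTV, hTspan, hTli⟩ := exists_linearIndependent K Vals
  -- a section of `value` over `T`
  have hsec : ∀ t : T, ∃ s : Σ n, KZ.IntegralRep n, s.2.value = (t : ℝ) := fun t => hTV t.2
  choose ρ hρ using hsec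
  have hρinj : Function.Injective ρ := by
    intro t t' h
    apply Subtype.ext
    rw [← hρ t, ← hρ t', h]
  refine ⟨Set.range ρ, ?_, ?_⟩
  · -- RIGIDITY
    intro F β hFB hβ hsum b hb
    -- the values of `B = range ρ` form a `K`-linearly independent family
    have hval : ∀ x : Set.range ρ, (x : Σ n, KZ.IntegralRep n).2.value ∈ T := by
      rintro ⟨x, t, rfl⟩
      rw [hρ t]
      exact t.2
    let f : Set.range ρ → T := fun x => ⟨_, hval x⟩
    have hf : Function.Injective f := by
      rintro ⟨x, t, rfl⟩ ⟨x', t', rfl⟩ h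
      have h1 : (ρ t).2.value = (ρ t').2.value := congrArg (fun y : T => (y : ℝ)) h
      rw [hρ t, hρ t'] at h1
      have : t = t' := Subtype.ext h1
      subst this
      rfl
    have hBli : LinearIndependent K (fun x : Set.range ρ => (x : Σ n, KZ.IntegralRep n).2.value) :=
      hTli.comp f hf
    rw [linearIndependent_iff'] at hBli
    -- the coefficients as elements of `K`
    let g : Set.range ρ → K := fun x =>
      if hx : (x : Σ n, KZ.IntegralRep n) ∈ F then
        ⟨β x, mem_algebraicClosure_iff.mpr (hβ x hx)⟩ else 0
    have hsmul : ∀ (k : K) (x : ℝ), k • x = (k : ℝ) * x := fun k x => rfl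
    have key := hBli (F.subtype (· ∈ Set.range ρ)) g ?_ ⟨b, hFB hb⟩ (Finset.mem_subtype.mpr hb)
    · have hgb : g ⟨b, hFB hb⟩ = ⟨β b, mem_algebraicClosure_iff.mpr (hβ b hb)⟩ := dif_pos hb
      rw [hgb] at key
      exact congrArg (fun y : K => (y : ℝ)) key
    · -- the `K`-combination is the given real combination
      have h1 : ∀ x ∈ F.subtype (· ∈ Set.range ρ),
          g x • (x : Σ n, KZ.IntegralRep n).2.value
            = β x * (x : Σ n, KZ.IntegralRep n).2.value := by
        intro x hx
        have hxF : (x : Σ n, KZ.IntegralRep n) ∈ F := Finset.mem_subtype.mp hx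
        have : g x = ⟨β x, mem_algebraicClosure_iff.mpr (hβ x hxF)⟩ := dif_pos hxF
        rw [this, hsmul]
      rw [Finset.sum_congr rfl h1]
      rw [Finset.sum_subtype_of_mem (fun x : Σ n, KZ.IntegralRep n => β x * x.2.value)
        (fun x hx => hFB hx)]
      exact hsum
  · -- REDUCTION
    intro n r _
    have hr : r.value ∈ Submodule.span K T := by
      rw [hTspan]
      exact Submodule.subset_span ⟨⟨n, r⟩, rfl⟩
    obtain ⟨c, hcT, hcsum⟩ := Submodule.mem_span_set.mp hr
    -- the rescaled copies
    have halg : ∀ t : ℝ, IsAlgebraic ℚ ((c t : K) : ℝ) := fun t =>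
      mem_algebraicClosure_iff.mp (c t).2
    let sc : c.support → Σ n, KZ.IntegralRep n := fun t =>
      ⟨(ρ ⟨t, hcT t.2⟩).1, (ρ ⟨t, hcT t.2⟩).2.constMul ((c t : K) : ℝ) (halg t)⟩
    refine ⟨∑ t ∈ c.support.attach, KZ.of (sc t).2, ?_, ?_⟩
    · refine AddSubgroup.sum_mem _ fun t _ => AddSubgroup.subset_closure ?_
      refine ⟨ρ ⟨t, hcT t.2⟩, ⟨_, rfl⟩, (sc t).2, ((c t : K) : ℝ), halg t, rfl, ?_, rfl⟩
      intro p _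
      rfl
    · apply hK
      have hx : KZ.eval (∑ t ∈ c.support.attach, KZ.of (sc t).2)
          = ∑ t ∈ c.support, ((c t : K) : ℝ) * t := by
        rw [map_sum]
        have h2 : ∀ t ∈ c.support.attach,
            KZ.eval (KZ.of (sc t).2) = ((c (t : ℝ) : K) : ℝ) * (t : ℝ) := by
          intro t _
          rw [KZ.eval_of]
          change ((ρ ⟨t, hcT t.2⟩).2.constMul ((c t : K) : ℝ) (halg t)).value = _
          rw [KZ.IntegralRep.value_constMul, hρ]
        rw [Finset.sum_congr rfl h2]
        exact Finset.sum_attach c.support (fun t : ℝ => ((c t : K) : ℝ) * t)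
      have hc' : (c.sum fun t k => k • t) = ∑ t ∈ c.support, ((c t : K) : ℝ) * t := rfl
      rw [map_sub, KZ.eval_of, hx, ← hc', hcsum, sub_self]

/-- **FIRST LEMMA of the card (proved):** the compact volume form of Conjecture 1 implies the crux
`ReductionRigidity`, with `B` a value-basis realised among all representations (by Viu-Sos'
reduction one may even take `B` among compact volumes). -/
theorem reductionRigidity_of_compactVolumeForm (h : CompactVolumeForm) : ReductionRigidity :=
  reductionRigidity_of_kernelForm (kernelForm_of_compactVolumeForm h)


/-- The hypothesis-free volume form, verbatim body of the shared frame item `VolumeForm`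
(stmt-KontsevichZagierPeriods-3814; routes ScissorsTransport, SphericalSchlafli, HardSphereVirial,
SymplecticScissors, BoundaryLevel, WeightFloor). -/
def VolumeForm3814 : Prop :=
  ∀ ⦃N : ℕ⦄ (r r' : KZ.IntegralRep N), (∀ x ∈ r.domain, r.integrand x = 1) →
    (∀ x ∈ r'.domain, r'.integrand x = 1) → r.value = r'.value → KZ.Equivalent r r'

theorem compactVolumeForm_of_volumeForm3814 (h : VolumeForm3814) : CompactVolumeForm :=
  fun _ r r' _ _ _ _ h1 h1' hv => h r r' h1 h1' hv

/-- The crux from the shared frame item 3814 (PROVED): `VolumeForm → ReductionRigidity`. -/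
theorem reductionRigidity_of_volumeForm3814 (h : VolumeForm3814) : ReductionRigidity :=
  reductionRigidity_of_compactVolumeForm (compactVolumeForm_of_volumeForm3814 h)

/-- X_ℤ, the INTEGRAL FORM of the crux: a family `B` of RATIONAL representations with
`ℚ`-linearly independent values such that a non-zero integer multiple of every rational
representation reduces by moves into the `ℤ`-span of `B` (no rescaled copies, no algebraic
coefficients). -/
def IntegralReductionRigidity : Prop :=
  ∃ B : Set (Σ n, KZ.IntegralRep n), (∀ b ∈ B, b.2.IsRational) ∧
    (∀ (F : Finset (Σ n, KZ.IntegralRep n)) (q : (Σ n, KZ.IntegralRep n) → ℤ), (↑F ⊆ B) →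
      ∑ b ∈ F, (q b : ℝ) * b.2.value = 0 → ∀ b ∈ F, q b = 0) ∧
    (∀ (n : ℕ) (r : KZ.IntegralRep n), r.IsRational → ∃ N : ℕ, N ≠ 0 ∧
      ∃ x ∈ AddSubgroup.closure ((fun b : Σ n, KZ.IntegralRep n => KZ.of b.2) '' B),
        N • KZ.of r - x ∈ KZ.relations)

/-- `P_KZ` is torsion-free (body of CoactionDevissage's support item `TorsionFree`, 3169). -/
def TorsionFree : Prop :=
  ∀ (n : ℕ) (c : KZ.FormalRep), n ≠ 0 → n • c ∈ KZ.relations → c ∈ KZ.relations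

/-- PROVED: the integral form plus torsion-freeness gives the kernel form — reduce `N[r₁] ≡ x`,
`N'[r₁'] ≡ x'` in the `ℤ`-span of `B` (rational replacements `r₁, r₁'` by
`KZ.exists_isRational_equivalent_holds`); an element of that span with value `0` is literally `0`
in the free abelian group by `ℚ`-independence (`FreeAbelianGroup.toFinsupp` supports); cancel
`N N'` by torsion-freeness. -/
theorem kernelForm_of_integral (hT : TorsionFree) (hZ : IntegralReductionRigidity) : KernelForm := by
  classical
  obtain ⟨B, -, hBrig, hBred⟩ := hZ
  -- (1) an element of the ℤ-span of `B` with value `0` is `0` in the free abelian group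
  have hspan0 : ∀ y ∈ AddSubgroup.closure ((fun b : Σ n, KZ.IntegralRep n => KZ.of b.2) '' B),
      KZ.eval y = 0 → y = 0 := by
    intro y hy hy0
    have hsupp : (↑(FreeAbelianGroup.support y) : Set (Σ n, KZ.IntegralRep n)) ⊆ B := by
      refine AddSubgroup.closure_induction (p := fun y _ =>
        (↑(FreeAbelianGroup.support y) : Set (Σ n, KZ.IntegralRep n)) ⊆ B) ?_ ?_ ?_ ?_ hy
      · rintro _ ⟨b, hb, rfl⟩
        change (↑(FreeAbelianGroup.support (FreeAbelianGroup.of b)) : Set _) ⊆ B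
        rw [FreeAbelianGroup.support_of, Finset.coe_singleton]
        exact Set.singleton_subset_iff.mpr hb
      · simp
      · intro a b _ _ ha hb s hs
        have hs' : s ∈ (FreeAbelianGroup.toFinsupp a + FreeAbelianGroup.toFinsupp b).support := by
          have : s ∈ (FreeAbelianGroup.toFinsupp (a + b)).support := hs
          rwa [map_add] at this
        rcases Finset.mem_union.mp (Finsupp.support_add hs') with h | h
        exacts [ha h, hb h]
      · intro a _ ha
        rwa [FreeAbelianGroup.support_neg]
    set f := FreeAbelianGroup.toFinsupp y with hf
    have hyf : y = f.sum (fun x n => n • FreeAbelianGroup.of x) := by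
      conv_lhs => rw [← Finsupp.toFreeAbelianGroup_toFinsupp y]
      rw [Finsupp.toFreeAbelianGroup, Finsupp.liftAddHom_apply]
      rfl
    have hev : KZ.eval y = ∑ x ∈ f.support, ((f x : ℤ) : ℝ) * x.2.value := by
      rw [hyf, map_finsuppSum]
      simp only [Finsupp.sum, map_zsmul, zsmul_eq_mul]
      refine Finset.sum_congr rfl fun x _ => ?_
      rw [show KZ.eval (FreeAbelianGroup.of x) = x.2.value from KZ.eval_of x.2]
    have hzero := hBrig f.support (fun x => f x) hsupp (by rw [← hev]; exact hy0)
    have hsup : f.support = ∅ :=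
      Finset.eq_empty_of_forall_notMem fun x hx => (Finsupp.mem_support_iff.mp hx) (hzero x hx)
    exact FreeAbelianGroup.support_eq_empty.mp hsup
  -- (2) the kernel form
  intro c hc
  obtain ⟨n, m, r, r', hrel⟩ := KZ.exists_integralRep_sub_holds c
  obtain ⟨n₁, r₁, hr₁, he₁⟩ := KZ.exists_isRational_equivalent_holds r
  obtain ⟨m₁, r₁', hr₁', he₁'⟩ := KZ.exists_isRational_equivalent_holds r'
  obtain ⟨N, hN, x, hx, hNx⟩ := hBred n₁ r₁ hr₁
  obtain ⟨N', hN', x', hx', hNx'⟩ := hBred m₁ r₁' hr₁'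
  have hv : r₁.value = r₁'.value := by
    have h1 := KZ.relations_le_ker_eval_holds hrel
    rw [AddMonoidHom.mem_ker, map_sub, hc, zero_sub, neg_eq_zero, map_sub, KZ.eval_of, KZ.eval_of,
      sub_eq_zero] at h1
    rw [← KZ.Equivalent.value_eq_holds he₁, ← KZ.Equivalent.value_eq_holds he₁', h1]
  have hex : KZ.eval x = N • r₁.value := by
    have h := KZ.relations_le_ker_eval_holds hNx
    rw [AddMonoidHom.mem_ker, map_sub, map_nsmul, KZ.eval_of, sub_eq_zero] at h
    exact h.symm
  have hex' : KZ.eval x' = N' • r₁'.value := by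
    have h := KZ.relations_le_ker_eval_holds hNx'
    rw [AddMonoidHom.mem_ker, map_sub, map_nsmul, KZ.eval_of, sub_eq_zero] at h
    exact h.symm
  have hy : N' • x - N • x' = 0 := by
    apply hspan0
    · exact sub_mem (AddSubgroup.nsmul_mem _ hx N') (AddSubgroup.nsmul_mem _ hx' N)
    · rw [map_sub, map_nsmul, map_nsmul, hex, hex', hv]
      simp only [nsmul_eq_mul]
      ring
  have hmul : (N' * N) • (KZ.of r₁ - KZ.of r₁') ∈ KZ.relations := by
    have h2 : (N' * N) • (KZ.of r₁ - KZ.of r₁')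
        = N' • (N • KZ.of r₁ - x) - N • (N' • KZ.of r₁' - x') + (N' • x - N • x') := by
      have e1 : N' • (N • KZ.of r₁) = (N' * N) • KZ.of r₁ := (mul_smul N' N _).symm
      have e2 : N • (N' • KZ.of r₁') = (N' * N) • KZ.of r₁' := by rw [← mul_smul, mul_comm]
      rw [smul_sub (N' * N), smul_sub N', smul_sub N, e1, e2]
      abel
    rw [h2, hy, add_zero]
    exact sub_mem (AddSubgroup.nsmul_mem _ hNx N') (AddSubgroup.nsmul_mem _ hNx' N)
  have hrr : KZ.of r₁ - KZ.of r₁' ∈ KZ.relations := hT (N' * N) _ (Nat.mul_ne_zero hN' hN) hmul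
  have hc' : c = (c - (KZ.of r - KZ.of r'))
      + ((KZ.of r - KZ.of r₁) + (KZ.of r₁ - KZ.of r₁') - (KZ.of r' - KZ.of r₁')) := by abel
  rw [hc']
  exact add_mem hrel (sub_mem (add_mem he₁ hrr) he₁')

/-- PROVED: kernel form ⇒ integral form, with `B` a section of `value` over a maximal
`ℚ`-linearly independent subset of the values of RATIONAL representations; reduction clears the
denominators of the `ℚ`-coordinates (`N = ∏ den`, `k t = num t · ∏_{u ≠ t} den u`). -/
theorem integral_of_kernelForm (hK : KernelForm) : IntegralReductionRigidity := by
  classical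
  let Vals : Set ℝ := {v | ∃ s : Σ n, KZ.IntegralRep n, s.2.IsRational ∧ s.2.value = v}
  obtain ⟨T, hTV, hTspan, hTli⟩ := exists_linearIndependent ℚ Vals
  have hsec : ∀ t : T, ∃ s : Σ n, KZ.IntegralRep n, s.2.IsRational ∧ s.2.value = (t : ℝ) :=
    fun t => hTV t.2
  choose ρ hρrat hρ using hsec
  refine ⟨Set.range ρ, ?_, ?_, ?_⟩
  · rintro _ ⟨t, rfl⟩
    exact hρrat t
  · -- RIGIDITY over ℤ, from ℚ-linear independence of the values
    intro F q hFB hsum b hb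
    have hval : ∀ x : Set.range ρ, (x : Σ n, KZ.IntegralRep n).2.value ∈ T := by
      rintro ⟨x, t, rfl⟩
      rw [hρ t]
      exact t.2
    let f : Set.range ρ → T := fun x => ⟨_, hval x⟩
    have hf : Function.Injective f := by
      rintro ⟨x, t, rfl⟩ ⟨x', t', rfl⟩ h
      have h1 : (ρ t).2.value = (ρ t').2.value := congrArg (fun y : T => (y : ℝ)) h
      rw [hρ t, hρ t'] at h1
      have : t = t' := Subtype.ext h1
      subst this
      rfl
    have hBli : LinearIndependent ℚ (fun x : Set.range ρ => (x : Σ n, KZ.IntegralRep n).2.value) :=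
      hTli.comp f hf
    rw [linearIndependent_iff'] at hBli
    have key := hBli (F.subtype (· ∈ Set.range ρ)) (fun x => (q x : ℚ)) ?_ ⟨b, hFB hb⟩
      (Finset.mem_subtype.mpr hb)
    · exact_mod_cast key
    · have h1 : ∀ x ∈ F.subtype (· ∈ Set.range ρ),
          ((q x : ℚ)) • (x : Σ n, KZ.IntegralRep n).2.value
            = (q x : ℝ) * (x : Σ n, KZ.IntegralRep n).2.value := by
        intro x _
        rw [Rat.smul_def, Rat.cast_intCast]
      rw [Finset.sum_congr rfl h1]
      rw [Finset.sum_subtype_of_mem (fun x : Σ n, KZ.IntegralRep n => (q x : ℝ) * x.2.value)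
        (fun x hx => hFB hx)]
      exact hsum
  · -- REDUCTION: clear denominators of the ℚ-coordinates of `value r`
    intro n r hr
    have hrT : r.value ∈ Submodule.span ℚ T := by
      rw [hTspan]
      exact Submodule.subset_span ⟨⟨n, r⟩, hr, rfl⟩
    obtain ⟨c, hcT, hcsum⟩ := Submodule.mem_span_set.mp hrT
    set N : ℕ := ∏ t ∈ c.support, (c t).den with hNdef
    have hN : N ≠ 0 :=
      Finset.prod_ne_zero_iff.mpr fun t _ => Nat.pos_iff_ne_zero.mp (c t).den_pos
    -- integer coefficients `k t` with `(k t : ℝ) = N * c t`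
    let k : ℝ → ℤ := fun t => (c t).num * ((∏ u ∈ c.support.erase t, (c u).den : ℕ) : ℤ)
    have hk : ∀ t ∈ c.support, ((k t : ℤ) : ℝ) = (N : ℝ) * ((c t : ℚ) : ℝ) := by
      intro t ht
      have hprod : (∏ u ∈ c.support.erase t, (c u).den) * (c t).den = N :=
        Finset.prod_erase_mul c.support (fun u => (c u).den) ht
      have h3 : ((c t).den : ℚ) * ((∏ u ∈ c.support.erase t, (c u).den : ℕ) : ℚ) = (N : ℚ) := by
        rw [mul_comm]
        exact_mod_cast hprod
      have h1 : ((c t).num : ℚ) = c t * (c t).den := (Rat.mul_den_eq_num (c t)).symm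
      have h2 : ((k t : ℤ) : ℚ) = (N : ℚ) * c t := by
        change (((c t).num * ((∏ u ∈ c.support.erase t, (c u).den : ℕ) : ℤ) : ℤ) : ℚ) = _
        rw [Int.cast_mul, Int.cast_natCast, h1, mul_assoc, h3, mul_comm]
      rw [← Rat.cast_intCast (k t), h2, Rat.cast_mul, Rat.cast_natCast]
    refine ⟨N, hN, ∑ t ∈ c.support.attach, (k t) • KZ.of (ρ ⟨t, hcT t.2⟩).2, ?_, ?_⟩
    · refine AddSubgroup.sum_mem _ fun t _ => AddSubgroup.zsmul_mem _ (AddSubgroup.subset_closure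
        (show KZ.of (ρ ⟨t, hcT t.2⟩).2 ∈ (fun b : Σ n, KZ.IntegralRep n => KZ.of b.2) '' Set.range ρ from
          ⟨ρ ⟨t, hcT t.2⟩, ⟨_, rfl⟩, rfl⟩)) _
    · apply hK
      have hx : KZ.eval (∑ t ∈ c.support.attach, (k t) • KZ.of (ρ ⟨t, hcT t.2⟩).2)
          = (N : ℝ) * ∑ t ∈ c.support, ((c t : ℚ) : ℝ) * t := by
        rw [map_sum]
        have h2 : ∀ t ∈ c.support.attach,
            KZ.eval ((k t) • KZ.of (ρ ⟨t, hcT t.2⟩).2) = (N : ℝ) * (((c (t : ℝ) : ℚ) : ℝ) * (t : ℝ)) := by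
          intro t _
          rw [map_zsmul, KZ.eval_of, hρ, zsmul_eq_mul, hk t t.2]
          ring
        rw [Finset.sum_congr rfl h2, ← Finset.mul_sum,
          Finset.sum_attach c.support (fun t : ℝ => ((c t : ℚ) : ℝ) * t)]
      have hc' : (c.sum fun t a => a • t) = ∑ t ∈ c.support, ((c t : ℚ) : ℝ) * t := by
        simp only [Finsupp.sum, Rat.smul_def]
      rw [map_sub, map_nsmul, KZ.eval_of, hx, ← hc', hcsum, nsmul_eq_mul, sub_self]

/-- Second concluding composition (PROVED): `TorsionFree → X_ℤ → ReductionRigidity`. Together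
with `reductionRigidity_of_volumeForm3814` and the route's `closes`, the crux, its integral form,
the kernel form and the (compact) volume form are all equivalent; the single open input of either
line is the shared frame item VolumeForm (stmt-3814) resp. X_ℤ itself. -/
theorem reductionRigidity_of_integral (hT : TorsionFree) (hZ : IntegralReductionRigidity) :
    ReductionRigidity :=
  reductionRigidity_of_kernelForm (kernelForm_of_integral hT hZ)

end Summit.KontsevichZagierPeriods.KontsevichZagierPeriods.Cruxes.ReductionRigidity.CompactVolumeBasis
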